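import Literature.MathematicalPhysics.QuantumFieldTheory.Balaban1983to89.Node00.Sect2FormOfRecord

/-!
# DAG node N11 — DEFINITIONS: TRUNCATION OF THE ALL-SCALE FLUCTUATION DATUM ABOVE A SCALE `k` IN THE §2 TERM VALUES (`truncTermValues k t`), the
# `k`-LOCALITY PREDICATE `IsFluctLocal k t`, and the transport of r11's law packages along the truncation

HEADER — WORK-UNIT METADATA.  Cell `pub-ymgap`, YM-PLAN Track A (HUMAN RULING D-0062), seat `pub-ymgap-dag-n11-d` (g10; R134 fan-out seat N11 [B14], strategy s2),
route `BalabanUVNodes` rev 25, item K1⁷ `StabilityBAtRecordR13SepCoPH` = stmt-QuantumFields-20542; DEFINITION lane (`--kind definition --supports 20542 --as helper`),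
count-neutral.  [III] = [Balaban1988Convergent].  Over 11b ∕ 11c (`Node00.Sect2FrameOfRecord`, `Node00.Sect2FormOfRecord`: `Sect2.TermValues`, `towerOfTerms`,
`actionDataOfTerms`, `sect2Operand`, the law packages `Sect2.LawsRT ∕ LawsT`) and r11 (`Step.LFHyp`, `LFHypImproved`, `LFNewTerms`, `B14.Eq227LocalizedTerms.LFHypAnalytic`).

WHY THIS FILE.  The off-diagonal residue of N11's no-expansion 𝐓-step (this seat's g9 file D, p569094 `…N11NoExpansionGeneralStepRePinnedIntegrable`, referee
READ-733) carries three binders on the §2 TERM DATA at the old sequence; the first is (hA): «the (2.23) action `A_k(init s′)` is `k`-LOCAL in the fluctuation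
argument» — needed because 11b's `Sect2.TermValues.B j X u a` takes the WHOLE all-scale fluctuation datum `a = ({S_i}, (A_i)_{i ∈ ℕ})` while (3.24) compares the old
operand at the two-scale configuration `(V_k, V_{k+1}) = (U, V′)` with the base configuration of `U` (p527289 (SL)).  In print the locality is automatic — the boundary
terms `𝐁^{(j)}(X, U_k, A, {S_i ∩ X})` of (2.40)–(2.41) are created at the step `j ≤ k` and cannot read fluctuation variables of later steps — and r11's law packages
say nothing about it (every clause of `LFHyp ∕ LFHypAnalytic ∕ LFHypImproved` involving `B` quantifies over ALL data `a`).  THE OBSERVATION this file and its sequel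
`…N11FluctTruncation` turn into kernel theorems: replacing a term family `t` by `truncTermValues k t`, whose 𝐁-terms read `a` through its truncation above `k`
(`A_i ↦ 0` for `i > k`), (i) preserves every law package, (ii) is `k`-local BY CONSTRUCTION, and (iii) changes NOTHING the operation `𝐓_k(s)` of record reads — 11a's
`TkOfRecord … k` evaluates its operand only at configurations with zero fluctuation variables above the integrated generations (`baseCfg_snd`; the generations
`j < k` update scale `j` only).  Hence the §2 laws of record have `k`-local witnesses and (hA) is dischargeable from `SLaw` alone (sequel, §3–§4).

WHAT THIS FILE DEFINES ∕ PROVES (2 `def` (functions) + 1 `structure … : Prop` (a bookkeeping predicate with parameters, NOT a cited result); theorems otherwise; 0 `sorry`,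
standard axioms; generic in the torus parameters, the coefficient algebra `𝔸`, the fluctuation value space `V` and the group `G`).
§1 `truncMSFluct k a` and its faces (`_of_le`, `_of_lt`, `_congr`, `_eq_self`, `_fluctFree`, `_idem`, `_agree`).
§2 `IsFluctLocal k t` (+ `.mono`), `truncTermValues k t`; faces `truncTermValues_E ∕ _R ∕ _B`, `isFluctLocal_truncTermValues`, `truncTermValues_B_of_fluctFree`,
   `IsFluctLocal.B_truncMSFluct`, `truncTermValues_truncTermValues_B`.
§3 LAW TRANSPORT: `lfHyp_truncTermValues`, `lfHypAnalytic_truncTermValues`, `lfHypImproved_truncTermValues`, `lfNewTerms_truncTermValues`, `lawsRT_truncTermValues`,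
   `lawsT_truncTermValues`, `universalE_truncTermValues`.
§4 ACTION FACES: `action23_truncTermValues` (the (2.23) action of the truncated family IS the action of `t` at the truncated datum), `action23_congr_fluct_of_isFluctLocal`,
   `action23_truncTermValues_congr_fluct` (THE (hA) SHAPE, hypothesis-free), `sect2Operand_truncTermValues`, `sect2Operand_truncTermValues_congr_fluct`.

HONEST FRAMING.  Definitions + `rfl`-level bookkeeping; nothing of Bałaban's is asserted; no law of record is edited or posited (the truncation is an operation on
WITNESSES of the existential §2 predicates, not a new row).  N11 NOT discharged; K1⁷ NOT closed; counts unmoved (typed 28∕28 · discharged 5∕27).  One finite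
four-torus programme at fixed `ε = L^{−K}` — NOT ℝ⁴, NOT OS, NOT a mass gap, NOT Clay.  No `sorry`, `axiom`, `instance`, `notation`.
Sources (SHAPE only): [III] (2.18) p.257, (2.20)–(2.23) p.258, (2.26)–(2.31) pp.259–260, (2.40)–(2.42) p.261, §2 p.262, (3.24) p.270.
-/

noncomputable section

namespace Summit.QuantumFields.YangMills.Theorems.BalabanUVNodesN11FluctTruncationDefs

open Literature.MathematicalPhysics.QuantumFieldTheory.Balaban1983to89 T4Continuum Node00 Node00.Tk
open Step B14.Eq227LocalizedTerms

universe u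

/-! ## §1  Truncation of the all-scale fluctuation variables above a scale -/

section TruncMS

variable {P : Params} {V : Type u} [Zero V]

/-- **TRUNCATION ABOVE SCALE `k`** of the all-scale fluctuation variables `(A_i)_{i ∈ ℕ}`: keep `A_i` for `i ≤ k`, replace it by `0` for `i > k` (the value the base
configuration of 11a's `TkOfRecord` carries at every scale it does not integrate). [cite: Balaban1988Convergent, (2.21) p.258, (2.18) p.257 (bookkeeping)] -/
def truncMSFluct (k : ℕ) (a : MSFluct P V) : MSFluct P V :=
  fun i => if i ≤ k then a i else 0

/-- On the scales `≤ k` the truncation keeps the variables. [cite: Balaban1988Convergent, (2.21) p.258 (bookkeeping)] -/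
theorem truncMSFluct_of_le (k : ℕ) (a : MSFluct P V) {i : ℕ} (hi : i ≤ k) : truncMSFluct k a i = a i := if_pos hi

/-- Above `k` the truncation is `0`. [cite: Balaban1988Convergent, (2.21) p.258 (bookkeeping)] -/
theorem truncMSFluct_of_lt (k : ℕ) (a : MSFluct P V) {i : ℕ} (hi : k < i) : truncMSFluct k a i = 0 := if_neg (Nat.not_le.mpr hi)

/-- Two data agreeing on the scales `≤ k` have the same truncation. [cite: Balaban1988Convergent, (2.21) p.258 (bookkeeping)] -/
theorem truncMSFluct_congr (k : ℕ) {a a' : MSFluct P V} (h : ∀ i, i ≤ k → a i = a' i) : truncMSFluct k a = truncMSFluct k a' := by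
  funext i
  by_cases hi : i ≤ k
  · rw [truncMSFluct_of_le k a hi, truncMSFluct_of_le k a' hi, h i hi]
  · rw [truncMSFluct_of_lt k a (Nat.lt_of_not_le hi), truncMSFluct_of_lt k a' (Nat.lt_of_not_le hi)]

/-- A datum vanishing above `k` is its own truncation. [cite: Balaban1988Convergent, (2.21) p.258 (bookkeeping)] -/
theorem truncMSFluct_eq_self (k : ℕ) {a : MSFluct P V} (h : ∀ i, k < i → a i = 0) : truncMSFluct k a = a := by
  funext i
  by_cases hi : i ≤ k
  · exact truncMSFluct_of_le k a hi
  · rw [truncMSFluct_of_lt k a (Nat.lt_of_not_le hi), h i (Nat.lt_of_not_le hi)]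

/-- The truncation vanishes above `k`. [cite: Balaban1988Convergent, (2.21) p.258 (bookkeeping)] -/
theorem truncMSFluct_fluctFree (k : ℕ) (a : MSFluct P V) : ∀ i, k < i → truncMSFluct k a i = 0 := fun _ hi => truncMSFluct_of_lt k a hi

/-- The truncation is idempotent. [cite: Balaban1988Convergent, (2.21) p.258 (bookkeeping)] -/
theorem truncMSFluct_idem (k : ℕ) (a : MSFluct P V) : truncMSFluct k (truncMSFluct k a) = truncMSFluct k a :=
  truncMSFluct_eq_self k (truncMSFluct_fluctFree k a)

/-- The truncation agrees with the datum on the scales `≤ k`. [cite: Balaban1988Convergent, (2.21) p.258 (bookkeeping)] -/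
theorem truncMSFluct_agree (k : ℕ) (a : MSFluct P V) : ∀ i, i ≤ k → truncMSFluct k a i = a i := fun _ hi => truncMSFluct_of_le k a hi

end TruncMS

/-! ## §2  Truncated term values and the `k`-locality predicate -/

section Terms

variable {P : Params} {𝔸 : Type*} {V : Type u} {M : ℕ}

/-- **`k`-LOCALITY OF THE BOUNDARY TERMS IN THE FLUCTUATION VARIABLES** (a bookkeeping predicate with parameters, not a cited result): for every scale `j`, domain `X`,
configuration `u` and `{S_i}`, the value `𝐁^{(j)}(X, u, ({S_i}, A))` depends on `A` only through `(A_i)_{i ≤ k}` — the shape of the binder (hA) of this seat's general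
no-expansion step (p543804 `action23_congr_fluct_of_B_local`). [cite: Balaban1988Convergent, (2.40)–(2.41) p.261, (3.24) p.270] -/
structure IsFluctLocal (k : ℕ) (t : Sect2.TermValues P 𝔸 V M) : Prop where
  /-- `𝐁^{(j)}(X, u, ({S_i}, A)) = 𝐁^{(j)}(X, u, ({S_i}, A′))` whenever `A_i = A′_i` for `i ≤ k`. -/
  B_congr : ∀ (j : ℕ) (X : (Sect2.domSys P M j).Dom) (u : Sect2.CPair P 𝔸) (S : ℕ → Set (Site P 0)) (a a' : MSFluct P V),
    (∀ i, i ≤ k → a i = a' i) → t.B j X u (S, a) = t.B j X u (S, a')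

/-- `k`-locality is monotone in the scale: a `k`-local family is `k'`-local for `k ≤ k'`. [cite: Balaban1988Convergent, (2.40)–(2.41) p.261 (bookkeeping)] -/
theorem IsFluctLocal.mono {k k' : ℕ} {t : Sect2.TermValues P 𝔸 V M} (h : IsFluctLocal k t) (hk : k ≤ k') : IsFluctLocal k' t :=
  ⟨fun j X u S a a' ha => h.B_congr j X u S a a' fun i hi => ha i (le_trans hi hk)⟩

variable [Zero V]

/-- **THE TRUNCATED TERM VALUES**: `𝐄`, `𝐑` unchanged; the boundary terms read the fluctuation datum through its truncation above `k`,
`𝐁^{(j)}(X, u, ({S_i}, A)) := 𝐁^{(j)}(X, u, ({S_i}, truncMSFluct k A))`.  (In print the terms `𝐁^{(j)}`, `j ≤ k`, created at the steps `≤ k`, do not read later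
fluctuation variables; 11b's `TermValues.B` takes the all-scale datum, so this is an operation on witnesses.) [cite: Balaban1988Convergent, (2.40)–(2.41) p.261, (2.21) p.258] -/
def truncTermValues (k : ℕ) (t : Sect2.TermValues P 𝔸 V M) : Sect2.TermValues P 𝔸 V M where
  E := t.E
  R := t.R
  B := fun j X u a => t.B j X u (a.1, truncMSFluct k a.2)

/-- The `𝐄`-terms of the truncated family are those of `t`. [cite: Balaban1988Convergent, (2.26)–(2.27) p.259 (bookkeeping)] -/
@[simp] theorem truncTermValues_E (k : ℕ) (t : Sect2.TermValues P 𝔸 V M) : (truncTermValues k t).E = t.E := rfl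

/-- The `𝐑`-terms of the truncated family are those of `t`. [cite: Balaban1988Convergent, (2.30) p.260 (bookkeeping)] -/
@[simp] theorem truncTermValues_R (k : ℕ) (t : Sect2.TermValues P 𝔸 V M) : (truncTermValues k t).R = t.R := rfl

/-- The `𝐁`-terms of the truncated family, unfolded. [cite: Balaban1988Convergent, (2.40)–(2.41) p.261 (bookkeeping)] -/
theorem truncTermValues_B (k : ℕ) (t : Sect2.TermValues P 𝔸 V M) (j : ℕ) (X : (Sect2.domSys P M j).Dom) (u : Sect2.CPair P 𝔸) (a : SFluct P V) :
    (truncTermValues k t).B j X u a = t.B j X u (a.1, truncMSFluct k a.2) := rfl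

/-- **THE TRUNCATED FAMILY IS `k`-LOCAL** (by construction). [cite: Balaban1988Convergent, (2.40)–(2.41) p.261] -/
theorem isFluctLocal_truncTermValues (k : ℕ) (t : Sect2.TermValues P 𝔸 V M) : IsFluctLocal k (truncTermValues k t) := by
  refine ⟨fun j X u S a a' h => ?_⟩
  rw [truncTermValues_B, truncTermValues_B]
  exact congrArg (fun b => t.B j X u (S, b)) (truncMSFluct_congr k h)

/-- At a datum with no fluctuation variables above `k` the truncated family takes the values of `t`. [cite: Balaban1988Convergent, (2.40)–(2.41) p.261 (bookkeeping)] -/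
theorem truncTermValues_B_of_fluctFree (k : ℕ) (t : Sect2.TermValues P 𝔸 V M) (j : ℕ) (X : (Sect2.domSys P M j).Dom) (u : Sect2.CPair P 𝔸)
    (S : ℕ → Set (Site P 0)) {a : MSFluct P V} (h : ∀ i, k < i → a i = 0) : (truncTermValues k t).B j X u (S, a) = t.B j X u (S, a) := by
  rw [truncTermValues_B]
  exact congrArg (fun b => t.B j X u (S, b)) (truncMSFluct_eq_self k h)

/-- A `k`-local family takes at every datum the value at its truncation (so truncating a `k`-local family changes no value of `𝐁`).
[cite: Balaban1988Convergent, (2.40)–(2.41) p.261 (bookkeeping)] -/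
theorem IsFluctLocal.B_truncMSFluct {k : ℕ} {t : Sect2.TermValues P 𝔸 V M} (h : IsFluctLocal k t) (j : ℕ) (X : (Sect2.domSys P M j).Dom)
    (u : Sect2.CPair P 𝔸) (S : ℕ → Set (Site P 0)) (a : MSFluct P V) : t.B j X u (S, truncMSFluct k a) = t.B j X u (S, a) :=
  h.B_congr j X u S _ _ (truncMSFluct_agree k a)

/-- Truncating twice at the same scale is truncating once (values of `𝐁`). [cite: Balaban1988Convergent, (2.40)–(2.41) p.261 (bookkeeping)] -/
theorem truncTermValues_truncTermValues_B (k : ℕ) (t : Sect2.TermValues P 𝔸 V M) (j : ℕ) (X : (Sect2.domSys P M j).Dom) (u : Sect2.CPair P 𝔸)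
    (a : SFluct P V) : (truncTermValues k (truncTermValues k t)).B j X u a = (truncTermValues k t).B j X u a := by
  rw [truncTermValues_B, truncTermValues_B, truncTermValues_B, truncMSFluct_idem]

end Terms

/-! ## §3  Transport of the law packages along the truncation -/

section Laws

variable {P : Params} {𝔸 : Type*} [NormedRing 𝔸] [NormedAlgebra ℂ 𝔸] [CompleteSpace 𝔸] {V : Type u} [Zero V] {M : ℕ} {G : Type*} [GaugeGroup G]

/-- **r11's INDUCTIVE BOUNDS TRANSPORT**: every clause of `Step.LFHyp` mentioning `𝐁` quantifies over all fluctuation data, the others read `𝐄`, `𝐑`, the flow and the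
frame, which the truncation does not touch. [cite: Balaban1988Convergent, (2.27)(i)–(iv) p.259, (2.31) p.260, (2.42) p.261] -/
theorem lfHyp_truncTermValues (S : Sect2.Setting 𝔸 G) (Rz : Sect2.Residual P 𝔸) (Ω : ℕ → Set (Site P 0)) (t : Sect2.TermValues P 𝔸 V M) (c : LFConsts)
    (n k : ℕ) (h : LFHyp (Sect2.towerOfTerms S Rz M Ω t) c n) : LFHyp (Sect2.towerOfTerms S Rz M Ω (truncTermValues k t)) c n where
  rg := h.rg
  localDepE := h.localDepE
  localDepR := h.localDepR
  boundE := h.boundE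
  boundR := h.boundR
  boundB := fun j h1 hj X φ a hφ => h.boundB j h1 hj X φ (a.1, truncMSFluct k a.2) hφ
  gaugeInvE := h.gaugeInvE
  gaugeInvR := h.gaugeInvR

/-- **THE ANALYTICITY CLAUSE TRANSPORTS** ((2.41)(ii) is demanded for every value of the fluctuation datum). [cite: Balaban1988Convergent, (2.27)(ii) p.259, (2.30) p.260, (2.41)(ii) p.261] -/
theorem lfHypAnalytic_truncTermValues (S : Sect2.Setting 𝔸 G) (Rz : Sect2.Residual P 𝔸) (Ω : ℕ → Set (Site P 0)) (t : Sect2.TermValues P 𝔸 V M)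
    (c : LFConsts) (n k : ℕ) (h : LFHypAnalytic (Sect2.towerOfTerms S Rz M Ω t) c n) :
    LFHypAnalytic (Sect2.towerOfTerms S Rz M Ω (truncTermValues k t)) c n where
  analyticE := h.analyticE
  analyticR := h.analyticR
  analyticB := fun j h1 hj X a => h.analyticB j h1 hj X (a.1, truncMSFluct k a.2)

/-- **THE IMPROVED BOUNDS OF THE NEWEST TERMS TRANSPORT** (p. 262). [cite: Balaban1988Convergent, §2 p.262] -/
theorem lfHypImproved_truncTermValues (S : Sect2.Setting 𝔸 G) (Rz : Sect2.Residual P 𝔸) (Ω : ℕ → Set (Site P 0)) (t : Sect2.TermValues P 𝔸 V M)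
    (c : LFConsts) (βc : ℝ) (n k : ℕ) (h : LFHypImproved (Sect2.towerOfTerms S Rz M Ω t) c βc n) :
    LFHypImproved (Sect2.towerOfTerms S Rz M Ω (truncTermValues k t)) c βc n where
  boundE := h.boundE
  boundR := h.boundR
  boundB := fun hn X φ a hφ => h.boundB hn X φ (a.1, truncMSFluct k a.2) hφ

/-- **THE NEW-TERM OBLIGATIONS TRANSPORT** (p. 262). [cite: Balaban1988Convergent, §2 p.262] -/
theorem lfNewTerms_truncTermValues (S : Sect2.Setting 𝔸 G) (Rz : Sect2.Residual P 𝔸) (Ω : ℕ → Set (Site P 0)) (t : Sect2.TermValues P 𝔸 V M)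
    (c : LFConsts) (βc : ℝ) (n k : ℕ) (h : LFNewTerms (Sect2.towerOfTerms S Rz M Ω t) c βc n) :
    LFNewTerms (Sect2.towerOfTerms S Rz M Ω (truncTermValues k t)) c βc n where
  rg := h.rg
  localDepE := h.localDepE
  localDepR := h.localDepR
  gaugeInvE := h.gaugeInvE
  gaugeInvR := h.gaugeInvR
  improved := lfHypImproved_truncTermValues S Rz Ω t c βc (n + 1) k h.improved

/-- **11c's INDUCTIVE-ASSUMPTION PACKAGE `LawsRT` TRANSPORTS.** [cite: Balaban1988Convergent, (2.27)–(2.31) pp.259–260, (2.41)–(2.42) p.261] -/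
theorem lawsRT_truncTermValues (S : Sect2.Setting 𝔸 G) (Rz : Sect2.Residual P 𝔸) (Ω : ℕ → Set (Site P 0)) (t : Sect2.TermValues P 𝔸 V M) (c : LFConsts)
    (n k : ℕ) (h : Sect2.LawsRT (Sect2.towerOfTerms S Rz M Ω t) c n) : Sect2.LawsRT (Sect2.towerOfTerms S Rz M Ω (truncTermValues k t)) c n :=
  ⟨lfHyp_truncTermValues S Rz Ω t c n k h.1, lfHypAnalytic_truncTermValues S Rz Ω t c n k h.2⟩

/-- **11c's 𝐓-IMAGE PACKAGE `LawsT` TRANSPORTS.** [cite: Balaban1988Convergent, §2 p.262, §3 p.279] -/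
theorem lawsT_truncTermValues (S : Sect2.Setting 𝔸 G) (Rz : Sect2.Residual P 𝔸) (Ω : ℕ → Set (Site P 0)) (t : Sect2.TermValues P 𝔸 V M) (c : LFConsts)
    (βc : ℝ) (n k : ℕ) (h : Sect2.LawsT (Sect2.towerOfTerms S Rz M Ω t) c βc n) :
    Sect2.LawsT (Sect2.towerOfTerms S Rz M Ω (truncTermValues k t)) c βc n :=
  ⟨lfHyp_truncTermValues S Rz Ω t c n k h.1, lfNewTerms_truncTermValues S Rz Ω t c βc n k h.2.1,
    lfHypAnalytic_truncTermValues S Rz Ω t c (n + 1) k h.2.2⟩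

omit [NormedRing 𝔸] [NormedAlgebra ℂ 𝔸] [CompleteSpace 𝔸] in
/-- **UNIVERSALITY OF THE 𝐄-TERMS TRANSPORTS** (the truncation does not touch `𝐄`). [cite: Balaban1988Convergent, (2.25)–(2.27) p.259 (bookkeeping)] -/
theorem universalE_truncTermValues {ι : Type*} {t : ι → Sect2.TermValues P 𝔸 V M} (h : Sect2.UniversalE t) (k : ι → ℕ) :
    Sect2.UniversalE (fun i => truncTermValues (k i) (t i)) :=
  fun i i' => h i i'

end Laws

/-! ## §4  The (2.23) action and the operand of the truncated family -/

section Action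

variable {P : Params} {𝔸 : Type*} [NormedRing 𝔸] [NormedAlgebra ℂ 𝔸] [CompleteSpace 𝔸] {V : Type u} {M : ℕ} {G : Type*} [GaugeGroup G]

/-- **A `k`-LOCAL FAMILY HAS A `k`-LOCAL (2.23) ACTION** at every length (the shape p543804 `action23_congr_fluct_of_B_local` consumes, here from `IsFluctLocal`): the only
summand of (2.23) reading the fluctuation datum is the substituted (2.40) sum. [cite: Balaban1988Convergent, (2.23) p.258, (2.40) p.261, (3.24) p.270] -/
theorem action23_congr_fluct_of_isFluctLocal (S : Sect2.Setting 𝔸 G) (Rz : Sect2.Residual P 𝔸) (ν : Stage7Numerics) (g : ℕ → ℝ) (Ω Λ : ℕ → Set (Site P 0))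
    {t : Sect2.TermValues P 𝔸 V M} {k : ℕ} (ht : IsFluctLocal k t) (n : ℕ) (S' : ℕ → Set (Site P 0)) (a a' : MSFluct P V) (h : ∀ i, i ≤ k → a i = a' i)
    (Ek : ℝ) (U : GaugeField P 0 G) :
    (Sect2.actionDataOfTerms S Rz ν M g Ω Λ t n (S', a) Ek).action23 n U = (Sect2.actionDataOfTerms S Rz ν M g Ω Λ t n (S', a') Ek).action23 n U := by
  rw [Sect2.action23_actionDataOfTerms, Sect2.action23_actionDataOfTerms]
  congr 2
  unfold B14.Eq225Concrete.B240
  refine Finset.sum_congr rfl fun j _ => Finset.sum_congr rfl fun X _ => ?_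
  split_ifs
  · exact congrArg Complex.re (ht.B_congr j X _ S' a a' h)
  · rfl

variable [Zero V]

/-- **THE (2.23) ACTION OF THE TRUNCATED FAMILY IS THE ACTION OF `t` AT THE TRUNCATED DATUM** (definitional: only the substituted (2.40) sum reads the datum).
[cite: Balaban1988Convergent, (2.23) p.258, (2.40) p.261] -/
theorem action23_truncTermValues (S : Sect2.Setting 𝔸 G) (Rz : Sect2.Residual P 𝔸) (ν : Stage7Numerics) (g : ℕ → ℝ) (Ω Λ : ℕ → Set (Site P 0))
    (t : Sect2.TermValues P 𝔸 V M) (k n : ℕ) (S' : ℕ → Set (Site P 0)) (a : MSFluct P V) (Ek : ℝ) (U : GaugeField P 0 G) :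
    (Sect2.actionDataOfTerms S Rz ν M g Ω Λ (truncTermValues k t) n (S', a) Ek).action23 n U =
      (Sect2.actionDataOfTerms S Rz ν M g Ω Λ t n (S', truncMSFluct k a) Ek).action23 n U := by
  rw [Sect2.action23_actionDataOfTerms, Sect2.action23_actionDataOfTerms]
  rfl

/-- **THE (hA) SHAPE FOR THE TRUNCATED FAMILY, HYPOTHESIS-FREE**: data agreeing on the scales `≤ k` give the same (2.23) action of `truncTermValues k t` at every length.
[cite: Balaban1988Convergent, (2.23) p.258, (2.40) p.261, (3.24) p.270] -/
theorem action23_truncTermValues_congr_fluct (S : Sect2.Setting 𝔸 G) (Rz : Sect2.Residual P 𝔸) (ν : Stage7Numerics) (g : ℕ → ℝ) (Ω Λ : ℕ → Set (Site P 0))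
    (t : Sect2.TermValues P 𝔸 V M) (k n : ℕ) (S' : ℕ → Set (Site P 0)) (a a' : MSFluct P V) (h : ∀ i, i ≤ k → a i = a' i) (Ek : ℝ) (U : GaugeField P 0 G) :
    (Sect2.actionDataOfTerms S Rz ν M g Ω Λ (truncTermValues k t) n (S', a) Ek).action23 n U =
      (Sect2.actionDataOfTerms S Rz ν M g Ω Λ (truncTermValues k t) n (S', a') Ek).action23 n U := by
  rw [action23_truncTermValues, action23_truncTermValues, truncMSFluct_congr k h]

/-- At a datum with no fluctuation variables above `k` the action of the truncated family is the action of `t`. [cite: Balaban1988Convergent, (2.23) p.258, (2.40) p.261] -/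
theorem action23_truncTermValues_of_fluctFree (S : Sect2.Setting 𝔸 G) (Rz : Sect2.Residual P 𝔸) (ν : Stage7Numerics) (g : ℕ → ℝ) (Ω Λ : ℕ → Set (Site P 0))
    (t : Sect2.TermValues P 𝔸 V M) (k n : ℕ) (S' : ℕ → Set (Site P 0)) {a : MSFluct P V} (ha : ∀ i, k < i → a i = 0) (Ek : ℝ) (U : GaugeField P 0 G) :
    (Sect2.actionDataOfTerms S Rz ν M g Ω Λ (truncTermValues k t) n (S', a) Ek).action23 n U =
      (Sect2.actionDataOfTerms S Rz ν M g Ω Λ t n (S', a) Ek).action23 n U := by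
  rw [action23_truncTermValues, truncMSFluct_eq_self k ha]

end Action

section Operand

variable {F : T4Family} {N : ℕ} [NeZero N] {𝔸 : Type*} [NormedRing 𝔸] [NormedAlgebra ℂ 𝔸] [CompleteSpace 𝔸] {V : Type} [Zero V]

/-- **THE OPERAND `exp A_n(s)` OF THE TRUNCATED FAMILY IS THE OPERAND OF `t` AT THE TRUNCATED DATUM.** [cite: Balaban1988Convergent, (2.18) p.257, (2.23) p.258, (2.40) p.261] -/
theorem sect2Operand_truncTermValues (K : ℕ) (S : Sect2.Setting 𝔸 (SU N)) (Rz : Sect2.Residual (F.P K) 𝔸) {ν : Stage7Numerics} {M : ℕ} {g : ℕ → ℝ} {n : ℕ}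
    (s : SeqOfRecord F ν M g K n) (t : Sect2.TermValues (F.P K) 𝔸 V M) (k : ℕ) (Ek : ℝ) (U : BgMap F N K) (S' : ℕ → Set (Site (F.P K) 0))
    (a : MSFluct (F.P K) V) (W : B15DeterminingSets.MSField (F.P K) (SU N)) :
    sect2Operand F N V K S Rz s (truncTermValues k t) Ek U (S', a) W = sect2Operand F N V K S Rz s t Ek U (S', truncMSFluct k a) W := by
  show Real.exp _ = Real.exp _
  rw [show (sect2ActionDataOfRecord F N V K S Rz s (truncTermValues k t) (S', a) Ek).action23 n (U W) =
      (sect2ActionDataOfRecord F N V K S Rz s t (S', truncMSFluct k a) Ek).action23 n (U W) from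
    action23_truncTermValues S Rz ν g s.Ω s.Λ t k n S' a Ek (U W)]

/-- At a datum with no fluctuation variables above `k` the operand of the truncated family is the operand of `t`. [cite: Balaban1988Convergent, (2.18) p.257, (2.23) p.258] -/
theorem sect2Operand_truncTermValues_of_fluctFree (K : ℕ) (S : Sect2.Setting 𝔸 (SU N)) (Rz : Sect2.Residual (F.P K) 𝔸) {ν : Stage7Numerics} {M : ℕ}
    {g : ℕ → ℝ} {n : ℕ} (s : SeqOfRecord F ν M g K n) (t : Sect2.TermValues (F.P K) 𝔸 V M) (k : ℕ) (Ek : ℝ) (U : BgMap F N K) (S' : ℕ → Set (Site (F.P K) 0))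
    {a : MSFluct (F.P K) V} (ha : ∀ i, k < i → a i = 0) (W : B15DeterminingSets.MSField (F.P K) (SU N)) :
    sect2Operand F N V K S Rz s (truncTermValues k t) Ek U (S', a) W = sect2Operand F N V K S Rz s t Ek U (S', a) W := by
  rw [sect2Operand_truncTermValues, truncMSFluct_eq_self k ha]

/-- **THE (hA) SHAPE AT THE RECORD, HYPOTHESIS-FREE** for the truncated family: the (2.23) action of record along `s` is `k`-local in the fluctuation argument.
[cite: Balaban1988Convergent, (2.23) p.258, (2.40) p.261, (3.24) p.270] -/
theorem action23_sect2ActionDataOfRecord_truncTermValues_congr_fluct (K : ℕ) (S : Sect2.Setting 𝔸 (SU N)) (Rz : Sect2.Residual (F.P K) 𝔸) {ν : Stage7Numerics}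
    {M : ℕ} {g : ℕ → ℝ} {n : ℕ} (s : SeqOfRecord F ν M g K n) (t : Sect2.TermValues (F.P K) 𝔸 V M) (k : ℕ) (Ek : ℝ) (S' : ℕ → Set (Site (F.P K) 0))
    (a a' : MSFluct (F.P K) V) (h : ∀ i, i ≤ k → a i = a' i) (U : GaugeField (F.P K) 0 (SU N)) :
    (sect2ActionDataOfRecord F N V K S Rz s (truncTermValues k t) (S', a) Ek).action23 n U =
      (sect2ActionDataOfRecord F N V K S Rz s (truncTermValues k t) (S', a') Ek).action23 n U :=
  action23_truncTermValues_congr_fluct S Rz ν g s.Ω s.Λ t k n S' a a' h Ek U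

omit [Zero V] in
/-- The same for any `k`-local family. [cite: Balaban1988Convergent, (2.23) p.258, (2.40) p.261, (3.24) p.270] -/
theorem action23_sect2ActionDataOfRecord_congr_fluct_of_isFluctLocal (K : ℕ) (S : Sect2.Setting 𝔸 (SU N)) (Rz : Sect2.Residual (F.P K) 𝔸) {ν : Stage7Numerics}
    {M : ℕ} {g : ℕ → ℝ} {n : ℕ} (s : SeqOfRecord F ν M g K n) {t : Sect2.TermValues (F.P K) 𝔸 V M} {k : ℕ} (ht : IsFluctLocal k t) (Ek : ℝ)
    (S' : ℕ → Set (Site (F.P K) 0)) (a a' : MSFluct (F.P K) V) (h : ∀ i, i ≤ k → a i = a' i) (U : GaugeField (F.P K) 0 (SU N)) :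
    (sect2ActionDataOfRecord F N V K S Rz s t (S', a) Ek).action23 n U = (sect2ActionDataOfRecord F N V K S Rz s t (S', a') Ek).action23 n U :=
  action23_congr_fluct_of_isFluctLocal S Rz ν g s.Ω s.Λ ht n S' a a' h Ek U

end Operand

end Summit.QuantumFields.YangMills.Theorems.BalabanUVNodesN11FluctTruncationDefs

end
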